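import Mathlib
import Summits.Ventures.HodgeRepro.Tier4.Target
import Summits.Ventures.HodgeRepro.Tier4.Line3.GramCongruence

/-!
# Tier4/Line3/ConjCongruence — the conjugate of a congruence (rung for L3.4 / L3.5)

Blind re-derivation cell `pub-hodge-repro`, Tier 4 «PROVE THE STEP» (README §9–§10), LINE L3, seat t4-L2-p3 on L3.5
`term_dominated` (lead S12234).

The two-sided ball of `Loc.supp` (Skeleton v0.16, S12405 (b)) is `x j − xm j ∈ (𝔭 𝔭̄)^N • L` with `𝔭̄ = map c 𝔭` the
conjugate prime.  The Gram congruence `GramCongruence.hform_sub_mem_smul` needs, besides this, the congruence of the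
CONJUGATE vector `conjVec c (x j − xm j)` (the first slot of `⟨·,·⟩_H` is conjugate-linear).  Since the ideal `𝔭 𝔭̄` is
stable under `c`, the second congruence FOLLOWS from the first — this file proves it:

* `conjLattice c L := span (conjVec c '' L)` — the conjugate lattice;
* `conjVec_smul` — `conjVec c (r • n) = cR r • conjVec c n` for a ring endomorphism `cR` of the coefficient ring `R`
  compatible with `c` (`algebraMap (cR r) = c (algebraMap r)`; for `R = 𝒪_E` and `c` an automorphism, `cR` is
  `NumberField.RingOfIntegers.mapRingHom c`);
* `conjVec_mem_smul` — `δ ∈ I • L ⇒ conjVec c δ ∈ (map cR I) • conjLattice c L`;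
* `map_mul_map_pow_eq` — for an involutive `cR`, `map cR ((P * map cR P)^N) = (P * map cR P)^N`: the two-sided ideal is
  `c`-stable;
* `conjVec_mem_smul_of_involutive` — the combination: `δ ∈ (P * map cR P)^N • L ⇒ conjVec c δ ∈ (P * map cR P)^N •
  conjLattice c L`;
* `conjLattice_fg` — the conjugate of a finitely generated lattice is finitely generated.

Nothing here asserts anything about the truth of (P); HC_CM is NOT proved by anyone in this repository.
-/

set_option autoImplicit false

noncomputable section

namespace Summit.Ventures.HodgeRepro.Tier4.Line3

section ConjCongruence

variable {E : Type*} [Field E] (c : E ≃+* E)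
variable {R : Type*} [CommRing R] [Algebra R E]

/-- The conjugate lattice: the `R`-span of the conjugates of the elements of `L`. -/
def conjLattice (L : Submodule R (Fin 3 → E)) : Submodule R (Fin 3 → E) :=
  Submodule.span R (conjVec c '' (L : Set (Fin 3 → E)))

/-- The conjugate of an element of `L` lies in the conjugate lattice. -/
theorem conjVec_mem_conjLattice {L : Submodule R (Fin 3 → E)} {n : Fin 3 → E} (hn : n ∈ L) :
    conjVec c n ∈ conjLattice c L :=
  Submodule.subset_span (Set.mem_image_of_mem _ hn)

variable (cR : R →+* R)

/-- `conjVec` is `cR`-semilinear. -/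
theorem conjVec_smul (hcR : ∀ r : R, algebraMap R E (cR r) = c (algebraMap R E r)) (r : R) (x : Fin 3 → E) :
    conjVec c (r • x) = cR r • conjVec c x := by
  funext k
  simp only [conjVec, Pi.smul_apply, Algebra.smul_def, map_mul, hcR]

/-- The conjugate of a finitely generated lattice is finitely generated. -/
theorem conjLattice_fg (hcR : ∀ r : R, algebraMap R E (cR r) = c (algebraMap R E r))
    {L : Submodule R (Fin 3 → E)} (hL : L.FG) : (conjLattice c L).FG := by
  obtain ⟨s, hsfin, hs⟩ := Submodule.fg_def.mp hL
  refine Submodule.fg_def.mpr ⟨conjVec c '' s, hsfin.image _, ?_⟩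
  unfold conjLattice
  rw [← hs]
  apply le_antisymm
  · exact Submodule.span_mono (Set.image_mono Submodule.subset_span)
  · rw [Submodule.span_le]
    rintro _ ⟨n, hn, rfl⟩
    refine Submodule.span_induction (p := fun n _ => conjVec c n ∈ Submodule.span R (conjVec c '' s))
      (fun a ha => Submodule.subset_span (Set.mem_image_of_mem _ ha)) ?_ ?_ ?_ hn
    · have h0 : conjVec c (0 : Fin 3 → E) = 0 := by
        funext k
        simp [conjVec]
      rw [h0]
      exact Submodule.zero_mem _
    · intro a b _ _ ha hb
      rw [conjVec_add]
      exact Submodule.add_mem _ ha hb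
    · intro r a _ ha
      rw [conjVec_smul c cR hcR]
      exact Submodule.smul_mem _ _ ha

/-- **The conjugate of a congruence.** `δ ∈ I • L` implies `conjVec c δ ∈ (map cR I) • conjLattice c L`. -/
theorem conjVec_mem_smul (hcR : ∀ r : R, algebraMap R E (cR r) = c (algebraMap R E r)) (I : Ideal R)
    (L : Submodule R (Fin 3 → E)) {δ : Fin 3 → E} (hδ : δ ∈ I • L) :
    conjVec c δ ∈ (Ideal.map cR I) • conjLattice c L := by
  refine Submodule.smul_induction_on hδ (fun r hr n hn => ?_) (fun a b ha hb => ?_)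
  · rw [conjVec_smul c cR hcR]
    exact Submodule.smul_mem_smul (Ideal.mem_map_of_mem cR hr) (conjVec_mem_conjLattice c hn)
  · rw [conjVec_add]
    exact Submodule.add_mem _ ha hb

/-- For an involutive `cR`, the ideal `(P · map cR P)^N` is `cR`-stable. -/
theorem map_mul_map_pow_eq (hinv : ∀ r, cR (cR r) = r) (P : Ideal R) (N : ℕ) :
    Ideal.map cR ((P * Ideal.map cR P) ^ N) = (P * Ideal.map cR P) ^ N := by
  have hcomp : cR.comp cR = RingHom.id R := RingHom.ext hinv
  rw [Ideal.map_pow, Ideal.map_mul, Ideal.map_map, hcomp, Ideal.map_id, mul_comm]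

/-- **The two-sided congruence is stable under conjugation.** -/
theorem conjVec_mem_smul_of_involutive (hcR : ∀ r : R, algebraMap R E (cR r) = c (algebraMap R E r))
    (hinv : ∀ r, cR (cR r) = r) (P : Ideal R) (N : ℕ)
    (L : Submodule R (Fin 3 → E)) {δ : Fin 3 → E} (hδ : δ ∈ (P * Ideal.map cR P) ^ N • L) :
    conjVec c δ ∈ (P * Ideal.map cR P) ^ N • conjLattice c L := by
  have h := conjVec_mem_smul c cR hcR _ L hδ
  rwa [map_mul_map_pow_eq cR hinv] at h

end ConjCongruence

end Summit.Ventures.HodgeRepro.Tier4.Line3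

end
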